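import Summits.ResolutionOfSingularities.ResolutionOfSingularities.Theorems.FrobeniusClosingPatchingRelPerfectConeMemberChartIdeals
import HarnessLib

/-!
# Crux `PatchingRelPerfect` (stmt-ResolutionOfSingularities-16161), chain w52 — CORE RUNG r2pt,
# part 1b: the quadric-cone member — regularity on the Rees charts of the point blow-up

[OURS · L1 W5.2 · rung] Continues `…ConeMemberChartIdeals.lean` (chart ideals of `K = (q) + 𝔪³`,
`q = x₀x₁ + x₂²`, and of the companion factors on the Rees charts `B_i` of `Bl_𝔪 Spec S`;
`(K Q₀) B_i = u⁵ · (u, F) · (u, e₀, e₁, e₂) · ((e₀, e₁, e₂)² + (u))`, `F = e₀e₁ + e₂²`).  Here the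
base `S` is regular local with regular system of parameters `x₀, …, x₃` and we PROVE:

* `isRegularRing_chart`, `isRegularRing_pol`, `isRegularRing_residue` —
  bookkeeping (Liu 8.1.19 (a) on the charts, tree `isRegularRing_blowupChart`);
* `isRegularRing_quot_span_u_F_zero/one/two` — on the charts `i = 0, 1, 2` the centre `V(u, F)`
  is a REGULAR surface (`F₀ = T₁ + T₂²`, `T₀ + T₂²`, `T₀T₁ + 1`: Jacobian criterion), hence
  `isRegular_of_isBlowup_map_KQ_of_ne_three` — every blow-up of `Spec B_i` along
  `(K Q₀) B_i = u⁵ (u, F)` is regular (the other two factors are the unit ideal as some `e_j = 1`;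
  Stacks 080B twist + Liu 8.1.19 (a), tree `isRegular_of_isBlowup_idealSheaf_of_quotient`);
* `isRegularLocalRing_quot_span_u_F_three` — on the VERTEX chart `i = 3` the centre
  `V(u, F) = 𝔸¹ × (quadric cone T₀T₁ + T₂² = 0)` is regular at every prime not containing some
  `e_j`, `j ≤ 2` — the input that the vertex-chart tower (part 2) transports two levels up.

Nothing here is a statement of the manuscript under review.

## References

* Q. Liu, *Algebraic Geometry and Arithmetic Curves*, OUP 2002, Thm. 8.1.19 (a). [Liu2002]
* The Stacks Project, Tags 080B, 0804, 0BIQ. [StacksProject]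
* H. Matsumura, *Commutative Ring Theory*, CUP 1986, Thms. 14.2, 16.2. [Matsumura1987]
-/

-- `Summit.<Summit>.<Sub>.Theorems` with `Sub = Summit` (single-conjunct summit, D-0017)
set_option linter.dupNamespace false

noncomputable section

open CategoryTheory CategoryTheory.Limits AlgebraicGeometry Literature.AlgebraicGeometry.Resolution
open IsLocalRing

namespace Summit.ResolutionOfSingularities.ResolutionOfSingularities.Theorems

namespace ConeRung

universe u

/-! ## Index bookkeeping in `Fin 4` (opaque inequality proofs for the chart variables) -/

/-- `1 ≠ 0` in `Fin 4`. [folklore] -/ theorem one_ne_zero4 : (1 : Fin 4) ≠ 0 := by decide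
/-- `2 ≠ 0` in `Fin 4`. [folklore] -/ theorem two_ne_zero4 : (2 : Fin 4) ≠ 0 := by decide
/-- `0 ≠ 1` in `Fin 4`. [folklore] -/ theorem zero_ne_one4 : (0 : Fin 4) ≠ 1 := by decide
/-- `2 ≠ 1` in `Fin 4`. [folklore] -/ theorem two_ne_one4 : (2 : Fin 4) ≠ 1 := by decide
/-- `0 ≠ 2` in `Fin 4`. [folklore] -/ theorem zero_ne_two4 : (0 : Fin 4) ≠ 2 := by decide
/-- `1 ≠ 2` in `Fin 4`. [folklore] -/ theorem one_ne_two4 : (1 : Fin 4) ≠ 2 := by decide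
/-- `0 ≠ 3` in `Fin 4`. [folklore] -/ theorem zero_ne_three4 : (0 : Fin 4) ≠ 3 := by decide
/-- `1 ≠ 3` in `Fin 4`. [folklore] -/ theorem one_ne_three4 : (1 : Fin 4) ≠ 3 := by decide
/-- `2 ≠ 3` in `Fin 4`. [folklore] -/ theorem two_ne_three4 : (2 : Fin 4) ≠ 3 := by decide

/-! ## Regularity on the charts over a regular local base -/

section Regularity

variable {S : Type u} [CommRing S] [IsRegularLocalRing S] (x : Fin 4 → S)
  (hx : Ideal.span (Set.range x) = IsLocalRing.maximalIdeal S)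
  (hd : (IsLocalRing.maximalIdeal S).spanFinrank = 4)

local notation3 "M" => Ideal.span (Set.range x)
local notation3 "KK" => Ideal.span {x 0 * x 1 + x 2 ^ 2} ⊔ Ideal.span (Set.range x) ^ 3
local notation3 "PP" => Ideal.span {x 0, x 1, x 2}

include hx in
/-- `(x) = 𝔪` is maximal. [folklore] -/
theorem isMaximal_span_rsop : (M).IsMaximal := hx ▸ IsLocalRing.maximalIdeal.isMaximal S

include hx in
/-- The residue field `S ⧸ (x)` is a regular ring. [folklore] -/
theorem isRegularRing_residue : IsRegularRing (S ⧸ M) := by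
  haveI := isMaximal_span_rsop x hx
  letI := Ideal.Quotient.field (M)
  infer_instance

include hx in
/-- The residue field `S ⧸ (x)` is a domain. [folklore] -/
theorem isDomain_residue : IsDomain (S ⧸ M) := by
  haveI := isMaximal_span_rsop x hx
  exact Ideal.Quotient.isDomain (M)

include hx hd in
/-- **The Rees charts of `Bl_𝔪 Spec S` are regular rings** (Liu 8.1.19 (a) on the charts, tree
`isRegularRing_blowupChart`). [cite: Liu2002, Thm. 8.1.19 (a) (affine charts)] -/
theorem isRegularRing_chart (i : Fin 4) : IsRegularRing (chartRing x i) := by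
  haveI : IsRegularRing S := isRegularRing_of_isRegularLocalRing S
  haveI := isRegularRing_residue x hx
  exact isRegularRing_blowupChart x i (isQuasiRegular_regularSystemOfParameters hd x hx)

include hx in
/-- The polynomial rings `κ[T_j : j ≠ i]` over the residue field are regular. [folklore] -/
theorem isRegularRing_pol (i : Fin 4) :
    IsRegularRing (MvPolynomial {j : Fin 4 // j ≠ i} (S ⧸ M)) := by
  haveI := isRegularRing_residue x hx
  infer_instance

/-! ### The chart of `x₀`, `x₁`, `x₂`: `V(u, F)` is a regular surface -/

include hx hd in
/-- **Chart `i = 0`: `B₀ ⧸ (u, F)` is a regular ring** (`F ≡ e₁ + e₂²`, a graph: `∂F₀/∂T₁ = 1`).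
[cite: Matsumura1987, Thm. 14.2] -/
theorem isRegularRing_quot_span_u_F_zero :
    IsRegularRing (chartRing x 0 ⧸ Ideal.span {chartBase x 0 (x 0),
      chartGen x 0 0 * chartGen x 0 1 + chartGen x 0 2 ^ 2}) := by
  haveI := isRegularRing_pol x hx 0
  have hqr := isQuasiRegular_regularSystemOfParameters hd x hx
  refine isRegularRing_quot_span_u_F x 0 hqr
    (MvPolynomial.X ⟨1, one_ne_zero4⟩ + MvPolynomial.X ⟨2, two_ne_zero4⟩ ^ 2) ?_ ?_
  · rw [chartQuotEquiv_apply, map_add, map_pow, chartQuotMap_X, chartQuotMap_X, ← map_pow,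
      ← map_add]
    congr 1
    rw [show chartGen x 0 0 = 1 from chartGen_self x 0]
    ring
  · intro Q hQ _
    refine ⟨⟨1, one_ne_zero4⟩, ?_⟩
    rw [map_add, MvPolynomial.pderiv_X_self, MvPolynomial.pderiv_pow,
      MvPolynomial.pderiv_X_of_ne (fun h => one_ne_two4 (congrArg Subtype.val h).symm),
      mul_zero, add_zero]
    exact Q.ne_top_iff_one.mp hQ.ne_top

include hx hd in
/-- **Chart `i = 1`: `B₁ ⧸ (u, F)` is a regular ring** (`F ≡ e₀ + e₂²`: `∂F₀/∂T₀ = 1`).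
[cite: Matsumura1987, Thm. 14.2] -/
theorem isRegularRing_quot_span_u_F_one :
    IsRegularRing (chartRing x 1 ⧸ Ideal.span {chartBase x 1 (x 1),
      chartGen x 1 0 * chartGen x 1 1 + chartGen x 1 2 ^ 2}) := by
  haveI := isRegularRing_pol x hx 1
  have hqr := isQuasiRegular_regularSystemOfParameters hd x hx
  refine isRegularRing_quot_span_u_F x 1 hqr
    (MvPolynomial.X ⟨0, zero_ne_one4⟩ + MvPolynomial.X ⟨2, two_ne_one4⟩ ^ 2) ?_ ?_
  · rw [chartQuotEquiv_apply, map_add, map_pow, chartQuotMap_X, chartQuotMap_X, ← map_pow,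
      ← map_add]
    congr 1
    rw [show chartGen x 1 1 = 1 from chartGen_self x 1]
    ring
  · intro Q hQ _
    refine ⟨⟨0, zero_ne_one4⟩, ?_⟩
    rw [map_add, MvPolynomial.pderiv_X_self, MvPolynomial.pderiv_pow,
      MvPolynomial.pderiv_X_of_ne (fun h => zero_ne_two4 (congrArg Subtype.val h).symm),
      mul_zero, add_zero]
    exact Q.ne_top_iff_one.mp hQ.ne_top

include hx hd in
/-- **Chart `i = 2`: `B₂ ⧸ (u, F)` is a regular ring** (`F ≡ e₀e₁ + 1`: `∂F₀/∂T₀ = T₁` is a unit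
modulo `F₀`). [cite: Matsumura1987, Thm. 14.2] -/
theorem isRegularRing_quot_span_u_F_two :
    IsRegularRing (chartRing x 2 ⧸ Ideal.span {chartBase x 2 (x 2),
      chartGen x 2 0 * chartGen x 2 1 + chartGen x 2 2 ^ 2}) := by
  haveI := isRegularRing_pol x hx 2
  have hqr := isQuasiRegular_regularSystemOfParameters hd x hx
  refine isRegularRing_quot_span_u_F x 2 hqr
    (MvPolynomial.X ⟨0, zero_ne_two4⟩ * MvPolynomial.X ⟨1, one_ne_two4⟩ + 1) ?_ ?_
  · rw [chartQuotEquiv_apply, map_add, map_mul, map_one, chartQuotMap_X, chartQuotMap_X,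
      ← map_mul, ← map_one (Ideal.Quotient.mk _), ← map_add]
    congr 1
    rw [show chartGen x 2 2 = 1 from chartGen_self x 2]
    ring
  · intro Q hQ hFQ
    refine ⟨⟨0, zero_ne_two4⟩, ?_⟩
    rw [map_add, MvPolynomial.pderiv_one, add_zero, MvPolynomial.pderiv_mul,
      MvPolynomial.pderiv_X_self,
      MvPolynomial.pderiv_X_of_ne (fun h => zero_ne_one4 (congrArg Subtype.val h).symm),
      mul_zero, add_zero, one_mul]
    intro h1
    apply hQ.ne_top ((Ideal.eq_top_iff_one Q).mpr ?_)
    have h2 : MvPolynomial.X ⟨0, zero_ne_two4⟩ * MvPolynomial.X ⟨1, one_ne_two4⟩ ∈ Q :=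
      Q.mul_mem_left _ h1
    have h3 := Q.sub_mem hFQ h2
    rwa [add_sub_cancel_left] at h3

include hx hd in
/-- **On the charts `i = 0, 1, 2` every blow-up of `Spec B_i` along `(K Q₀) B_i = u⁵ (u, F)` is
regular**: the factors `(u, e₀, e₁, e₂)` and `(e₀, e₁, e₂)² + (u)` are the unit ideal (some
`e_j = 1`), `u⁵` twists off (Stacks 080B), and `V(u, F)` is a regular centre in the regular chart
(Liu 8.1.19 (a)). [cite: Liu2002, Thm. 8.1.19 (a)] [cite: StacksProject, Tag 080B (proof)] -/
theorem isRegular_of_isBlowup_map_KQ_of_ne_three (i : Fin 4) (hi : i ≠ 3) {Y : Scheme.{u}}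
    {ρ : Y ⟶ Spec (.of (chartRing x i))}
    (hρ : IsBlowup ρ (affineBlowup.idealSheaf
      ((KK * ((PP ⊔ M ^ 2) * (PP ^ 2 ⊔ M ^ 3))).map (chartBase x i)))) :
    Scheme.IsRegular Y := by
  haveI := isRegularRing_chart x hx hd i
  have hone : (1 : chartRing x i) ∈ ({chartGen x i 0, chartGen x i 1, chartGen x i 2} :
      Set (chartRing x i)) := by
    fin_cases i
    · exact Or.inl (chartGen_self x _).symm
    · exact Or.inr (Or.inl (chartGen_self x _).symm)
    · exact Or.inr (Or.inr (chartGen_self x _).symm)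
    · exact absurd rfl hi
  have htop : Ideal.span {chartGen x i 0, chartGen x i 1, chartGen x i 2} = ⊤ :=
    Ideal.eq_top_of_isUnit_mem _ (Ideal.subset_span hone) isUnit_one
  have htop' :
      Ideal.span {chartBase x i (x i), chartGen x i 0, chartGen x i 1, chartGen x i 2} = ⊤ := by
    rw [Ideal.span_insert, htop, sup_top_eq]
  rw [map_chartBase_KQ, htop, htop', Ideal.top_pow, top_sup_eq, Ideal.top_mul, Ideal.mul_top] at hρ
  have hu : chartBase x i (x i) ^ 5 ∈ nonZeroDivisors (chartRing x i) :=
    Submonoid.pow_mem _ (reesChartBase_mem_nonZeroDivisors (x i)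
      (Ideal.mem_span_range_self (f := x) (x := i))) 5
  haveI : IsRegularRing (chartRing x i ⧸ Ideal.span {chartBase x i (x i),
      chartGen x i 0 * chartGen x i 1 + chartGen x i 2 ^ 2}) := by
    fin_cases i
    · exact isRegularRing_quot_span_u_F_zero x hx hd
    · exact isRegularRing_quot_span_u_F_one x hx hd
    · exact isRegularRing_quot_span_u_F_two x hx hd
    · exact absurd rfl hi
  exact isRegular_of_isBlowup_span_singleton_mul_of_forall hu _
    (fun Y' ρ' h' => isRegular_of_isBlowup_idealSheaf_of_quotient _ h') hρ

/-! ### The vertex chart `x₃`: `V(u, F) = 𝔸¹ × (quadric cone)` is regular off the vertex -/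

include hx hd in
/-- **Chart `i = 3`: `B₃ ⧸ (u, F)` is a regular local ring at every prime not containing some
`e_j`, `j ≤ 2`** (`F₀ = T₀T₁ + T₂²`; `∂F₀/∂T₁ = T₀`, `∂F₀/∂T₀ = T₁`, and `T₂ ∉ P` forces
`T₀ ∉ P`).  The vertex line `V(u, e₀, e₁, e₂)` is where this centre is singular.
[cite: Matsumura1987, Thm. 14.2] -/
theorem isRegularLocalRing_quot_span_u_F_three
    (Pbar : Ideal (chartRing x 3 ⧸ Ideal.span {chartBase x 3 (x 3),
      chartGen x 3 0 * chartGen x 3 1 + chartGen x 3 2 ^ 2})) [Pbar.IsPrime] (j : Fin 3)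
    (hj : Ideal.Quotient.mk _ (chartGen x 3 (Fin.castSucc j)) ∉ Pbar) :
    IsRegularLocalRing (Localization.AtPrime Pbar) := by
  haveI := isRegularRing_pol x hx 3
  have hqr := isQuasiRegular_regularSystemOfParameters hd x hx
  set F₀ : MvPolynomial {j : Fin 4 // j ≠ 3} (S ⧸ M) :=
    MvPolynomial.X ⟨0, zero_ne_three4⟩ * MvPolynomial.X ⟨1, one_ne_three4⟩ +
      MvPolynomial.X ⟨2, two_ne_three4⟩ ^ 2 with hF₀def
  have hF₀ : chartQuotEquiv x 3 hqr F₀ = Ideal.Quotient.mk _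
      (chartGen x 3 0 * chartGen x 3 1 + chartGen x 3 2 ^ 2) := by
    rw [hF₀def, chartQuotEquiv_apply, map_add, map_mul, map_pow, chartQuotMap_X, chartQuotMap_X,
      chartQuotMap_X, ← map_mul, ← map_pow, ← map_add]
  have hd0 : MvPolynomial.pderiv ⟨1, one_ne_three4⟩ F₀ = MvPolynomial.X ⟨0, zero_ne_three4⟩ := by
    rw [hF₀def, map_add, MvPolynomial.pderiv_mul, MvPolynomial.pderiv_X_self,
      MvPolynomial.pderiv_X_of_ne (fun h => zero_ne_one4 (congrArg Subtype.val h)),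
      MvPolynomial.pderiv_pow,
      MvPolynomial.pderiv_X_of_ne (fun h => one_ne_two4 (congrArg Subtype.val h).symm),
      zero_mul, zero_add, mul_one, mul_zero, add_zero]
  have hd1 : MvPolynomial.pderiv ⟨0, zero_ne_three4⟩ F₀ = MvPolynomial.X ⟨1, one_ne_three4⟩ := by
    rw [hF₀def, map_add, MvPolynomial.pderiv_mul, MvPolynomial.pderiv_X_self,
      MvPolynomial.pderiv_X_of_ne (fun h => zero_ne_one4 (congrArg Subtype.val h).symm),
      MvPolynomial.pderiv_pow,
      MvPolynomial.pderiv_X_of_ne (fun h => zero_ne_two4 (congrArg Subtype.val h).symm),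
      one_mul, mul_zero, add_zero, mul_zero, add_zero]
  -- `e₀ ∉ P̄` or `e₁ ∉ P̄`
  have key : Ideal.Quotient.mk _ (chartGen x 3 0) ∉ Pbar ∨
      Ideal.Quotient.mk _ (chartGen x 3 1) ∉ Pbar := by
    fin_cases j
    · exact Or.inl hj
    · exact Or.inr hj
    · left
      intro h0
      apply hj
      -- `ē₂² = -ē₀ē₁ ∈ P̄`
      have hF : Ideal.Quotient.mk (Ideal.span {chartBase x 3 (x 3),
          chartGen x 3 0 * chartGen x 3 1 + chartGen x 3 2 ^ 2})
          (chartGen x 3 0 * chartGen x 3 1 + chartGen x 3 2 ^ 2) = 0 :=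
        Ideal.Quotient.eq_zero_iff_mem.mpr (Ideal.subset_span (Or.inr rfl))
      rw [map_add, map_mul, map_pow] at hF
      have h2 : Ideal.Quotient.mk _ (chartGen x 3 2) ^ 2 ∈ Pbar := by
        rw [eq_neg_of_add_eq_zero_right hF]
        exact Pbar.neg_mem_iff.mpr (Pbar.mul_mem_right _ h0)
      exact Ideal.IsPrime.mem_of_pow_mem ‹_› 2 h2
  rcases key with h | h
  · exact isRegularLocalRing_localization_quot_span_u_F x 3 hqr F₀ hF₀ Pbar ⟨1, one_ne_three4⟩
      (chartGen x 3 0) (by rw [hd0, chartQuotEquiv_apply, chartQuotMap_X]) h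
  · exact isRegularLocalRing_localization_quot_span_u_F x 3 hqr F₀ hF₀ Pbar ⟨0, zero_ne_three4⟩
      (chartGen x 3 1) (by rw [hd1, chartQuotEquiv_apply, chartQuotMap_X]) h

end Regularity

end ConeRung

end Summit.ResolutionOfSingularities.ResolutionOfSingularities.Theorems

end
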